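import Summits.BirchSwinnertonDyer.BirchSwinnertonDyer.Theorems.KimAtThreeD7uTamagawaComponent
import HarnessLib

/-!
# The TAMAGAWA-DIVISIBLE bad places, IV: the Galois descent `E(K_v)[p^∞] → Φ_v = X(K_v)/X₀(K_v)` has
# kernel the core and image `Φ_v[p^∞]`: `#{t ∈ E[p^∞]^{D_v} : p^n t ∈ core} = #(E[p^∞]^{D_v} ∩ core) · #Φ_v[p^n]`
# (cell `bsd-addord`, seat w2-tamdiv gen 4; route W2 `KimAtThreeKolyvagin`, items 19562 / 19560, «TamDiv∞»,
# POSITIVE exponent)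

HONEST FRAMING: TOOL theorems (no definition, no named fact, no `sorry`); closes nothing by itself;
nothing is booked; BSD is not proved by any of this.  Continues `KimAtThreeD7uTamagawaComponent` (on
`p`-power torsion, core of `E[p^∞]^{I_v}` = points with non-singular reduction).  This is the E-SPECIFIC
count behind the positive-exponent Tamagawa index (Rubin, *Euler Systems*, Lemma 1.3.5; Büyükboduk,
JNT 129 (2009) §2.1.2 Remark 2; [MR04] Prop. 6.2.6): Grothendieck's `Φ_v[p^∞] ≅ (E[p^∞]^{I_v}/E₀-part)^{Fr}`
(SGA 7 IX 11.6–11.7) as a counting statement on the minimal model `X = M ⊗ K_v`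
(`M = W.localMinimalIntegralModel v`, `X₀(K_v) = nonsingularReductionSubgroup`, `c_v = [X(K_v) : X₀(K_v)]`).

## What (any number field `K`, `v ∤ p`, `𝔓₀ = adicCompletionPrime K v`)

* `natCard_comap_eq_card_ker_mul` — counting along a homomorphism: `#f⁻¹(S) = #ker f · #S` for `S ≤ im f`.
* **`natCard_decompositionFixed_nsmul_core_eq`**: for every `n`,
  `#{t ∈ E[p^∞]^{D_{𝔓₀}} : p^n • t ∈ core} = #{t ∈ E[p^∞]^{D_{𝔓₀}} : t ∈ core} · #Φ_v[p^n]` — the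
  `D_{𝔓₀}`-fixed `p`-power torsion descends to `X(K_v)` (route p2's (g4) construction, as in
  `relIndex_nonsingularPrimary_ker_eq_pow`), additively, with "non-singular reduction" = "core"
  (part III); composed with `X(K_v) → Φ_v` it has kernel the core and image EXACTLY `Φ_v[p^∞]` (rational
  `p`-power torsion reaches the `p`-Sylow of `Φ_v`, `exists_torsion_sub_mem_nonsingularReductionSubgroup`;
  torsion is algebraic), so the preimage of `Φ_v[p^n]` is counted by the kernel times `#Φ_v[p^n]`.  With
  `#Φ_v = c_v` this is the order `#(E(K_v)[p^∞]/E₀(K_v)[p^∞]) = (c_v)_p` of Greenberg's Lemma 3.3 in the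
  form the level-`p^{k+1}` index needs.

Sequel: `KimAtThreeD7uTamagawaIndex` (`#𝓕_can(w)_k = #𝓕_u(w)_k · #Φ_w[p^{k+1}]` over `ℚ`).
References: A. Grothendieck, SGA 7 I, Exp. IX §11 (11.6–11.7); R. Greenberg, LNM 1716 (1999) §3 Lemma 3.3
(p. 87) and §4 p. 74; J. H. Silverman, *AEC* VII.§2, VII.3.1, Cor. VII.6.2, Prop. VII.6.3, Ex. 7.6.
-/

noncomputable section

-- the cell's Theorems namespace `Summit.BirchSwinnertonDyer.BirchSwinnertonDyer.…` repeats the summit name by design (D-0017)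
set_option linter.dupNamespace false

open scoped Classical NNReal NumberField
open Function Field IsDedekindDomain NumberField WeierstrassCurve
open Literature.NumberTheory.EllipticCurves Literature.NumberTheory.EllipticCurves.GreenbergSelmer
open Literature.NumberTheory.GaloisRepresentations
open Summit.BirchSwinnertonDyer.Rank1Residual.GaloisImage
open Summit.BirchSwinnertonDyer.Rank1Residual.GaloisImage.InertiaDivisible
open Summit.BirchSwinnertonDyer.Rank1Residual.X11b.AcSelmer
open Summit.BirchSwinnertonDyer.BirchSwinnertonDyer.Theorems.KimAtThreeD7uTamagawaCore

namespace Summit.BirchSwinnertonDyer.BirchSwinnertonDyer.Theorems.KimAtThreeD7uTamagawaComponent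

variable {K : Type} [Field K] [NumberField K] (W : WeierstrassCurve K) [W.IsElliptic] (p : ℕ)
  [hp : Fact p.Prime] {v : HeightOneSpectrum (𝓞 K)}

/-! ### §2 The descent `E[p^∞]^{D_{𝔓₀}} → Φ_v = X(K_v)/X₀(K_v)`: kernel the core, image `Φ_v[p^∞]` -/

section Count

omit hp in
/-- Counting along a homomorphism: for `f : A → B` and a subgroup `S ≤ range f`,
`#f⁻¹(S) = #ker f · #S` (finite `A`). [folklore] -/
theorem natCard_comap_eq_card_ker_mul {A B : Type*} [AddCommGroup A] [AddCommGroup B] [Finite A]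
    (f : A →+ B) (S : AddSubgroup B) (hS : S ≤ f.range) :
    Nat.card (S.comap f) = Nat.card f.ker * Nat.card S := by
  let g : S.comap f →+ S :=
    { toFun := fun x => ⟨f x, x.2⟩
      map_zero' := Subtype.ext (map_zero f)
      map_add' := fun a b => Subtype.ext (map_add f _ _) }
  have hg : ∀ x : S.comap f, ((g x : S) : B) = f x := fun _ => rfl
  have hsurj : Function.Surjective g := by
    rintro ⟨b, hb⟩
    obtain ⟨a, ha⟩ := hS hb
    exact ⟨⟨a, by rw [AddSubgroup.mem_comap, ha]; exact hb⟩, Subtype.ext ha⟩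
  have hrange : Nat.card g.range = Nat.card S := by
    rw [AddMonoidHom.range_eq_top.mpr hsurj]; exact Nat.card_congr AddSubgroup.topEquiv.toEquiv
  have hker : Nat.card g.ker = Nat.card f.ker := by
    refine Nat.card_congr ?_
    exact
      { toFun := fun x => ⟨((x : S.comap f) : A), by
          have h := (AddMonoidHom.mem_ker).mp x.2
          have h' := congrArg (fun z : S => (z : B)) h
          rw [hg] at h'
          exact (AddMonoidHom.mem_ker).mpr h'⟩
        invFun := fun x => ⟨⟨(x : A), by
            rw [AddSubgroup.mem_comap, (AddMonoidHom.mem_ker).mp x.2]; exact zero_mem _⟩,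
          (AddMonoidHom.mem_ker).mpr (Subtype.ext ((AddMonoidHom.mem_ker).mp x.2))⟩
        left_inv := fun x => Subtype.ext (Subtype.ext rfl)
        right_inv := fun x => Subtype.ext rfl }
  have h1 : Nat.card (S.comap f) = Nat.card g.ker * Nat.card g.range := by
    rw [← Nat.card_congr (QuotientAddGroup.quotientKerEquivRange g).toEquiv, mul_comm]
    exact AddSubgroup.card_eq_card_quotient_mul_card_addSubgroup g.ker
  rw [h1, hker, hrange]

/-- **The Galois-descent count** (`v ∤ p`, any reduction type): for every `n`,
`#{t ∈ E[p^∞]^{D_{𝔓₀}} : p^n • t ∈ core} = #{t ∈ E[p^∞]^{D_{𝔓₀}} : t ∈ core} · #Φ_v[p^n]`,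
`Φ_v = X(K_v)/X₀(K_v)` on the minimal model (a group of order `c_v`).  The `D_{𝔓₀}`-fixed `p`-power
torsion points descend to `X(K_v)` (`exists_point_map_eq_of_forall_map_eq`, route p2's (g4) construction),
additively, with "non-singular reduction" corresponding to "core" (§1 + `hasNonsingularReduction_algebraMap_iff`);
composing with `X(K_v) → Φ_v` gives `δ` with `ker δ = core ∩ E[p^∞]^{D}` and `range δ = Φ_v[p^∞]` (rational
`p`-power torsion reaches the `p`-Sylow of `Φ_v`, `exists_torsion_sub_mem_nonsingularReductionSubgroup`;
torsion points are algebraic, `exists_pointsMapOfEmb_eq_of_nsmul_eq_zero`); `δ⁻¹(Φ_v[p^n])` is the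
left-hand set.  This is Grothendieck's `Φ_v[p^∞] ≅ (E[p^∞]^{I_v}/E₀-part)^{Fr}` (SGA 7 IX 11.6–11.7),
the E-specific order `#(E(K_v)[p^∞]/E₀(K_v)[p^∞]) = (c_v)_p` of Greenberg's Lemma 3.3.
[cite: GreenbergLNM1716, §3 Lemma 3.3 (p. 87) and §4 proof of Thm. 4.1 (p. 74)]
[cite: SilvermanAEC2009, §VII.6 (Ex. 7.6) and VIII.§1] -/
theorem natCard_decompositionFixed_nsmul_core_eq (hpv : (p : 𝓞 K) ∉ v.asIdeal) (n : ℕ) :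
    Nat.card {t : W.geomPrimaryTorsion p //
        (∀ d ∈ (adicCompletionPrime K v).decompositionSubgroup (absoluteGaloisGroup K), d • t = t) ∧
        ∀ k : ℕ, ∃ y : W.geomPrimaryTorsion p,
          (∀ i ∈ (adicCompletionPrime K v).inertia (absoluteGaloisGroup K), i • y = y) ∧
            p ^ k • y = p ^ n • t} =
      Nat.card {t : W.geomPrimaryTorsion p //
        (∀ d ∈ (adicCompletionPrime K v).decompositionSubgroup (absoluteGaloisGroup K), d • t = t) ∧
        ∀ k : ℕ, ∃ y : W.geomPrimaryTorsion p,
          (∀ i ∈ (adicCompletionPrime K v).inertia (absoluteGaloisGroup K), i • y = y) ∧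
            p ^ k • y = t} *
      Nat.card (AddSubgroup.torsionBy
        (((W.localMinimalIntegralModel v).baseChange (v.adicCompletion K)).toAffine.Point ⧸
          (W.localMinimalIntegralModel v).nonsingularReductionSubgroup
            (integers_valuationRing_valuation (v.adicCompletionIntegers K) (v.adicCompletion K)))
        (p ^ n : ℕ)) := by
  have hpp : (p : ℕ).Prime := hp.out
  -- local data: spectral valuation, a prime above, an `𝒪_w`-model, an equivariant transport
  obtain ⟨w, hw⟩ := v.exists_spectralValuation
  obtain ⟨𝔐, h𝔐⟩ := v.localPrimesAbove_nonempty
  have hint := WeierstrassCurve.isIntegral_spectralValuation_baseChange hw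
    (W.localMinimalIntegralModel v)
  obtain ⟨W₀, hW₀⟩ := hint.integral
  obtain ⟨C, hC⟩ := W.exists_variableChange_eq_localMinimalIntegralModel v
  obtain ⟨Φ, hΦ⟩ := W.exists_addEquiv_localPoints_of_smul_eq v hC
  -- notation
  let X := (W.localMinimalIntegralModel v).map (algebraMap (v.adicCompletionIntegers K)
    (v.adicCompletion K))
  haveI : X.IsElliptic := W.isElliptic_map_localMinimalIntegralModel (v := v)
  set I : Subgroup (absoluteGaloisGroup K) := (adicCompletionPrime K v).inertia (absoluteGaloisGroup K)
    with hIdef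
  set Dv : Subgroup (absoluteGaloisGroup K) :=
    (adicCompletionPrime K v).decompositionSubgroup (absoluteGaloisGroup K) with hDvdef
  have hIle : I ≤ Dv := Ideal.inertia_le_decompositionSubgroup _ _
  let Tor := W.geomPrimaryTorsion p
  let P : Tor → Prop := fun x => ∀ k : ℕ, ∃ y : Tor, (∀ i ∈ I, i • y = y) ∧ p ^ k • y = x
  let D : AddSubgroup Tor :=
    { carrier := {t | ∀ d ∈ Dv, d • t = t}
      add_mem' := fun {a b} ha hb d hd ↦ by rw [smul_add, ha d hd, hb d hd]
      zero_mem' := fun d _ ↦ smul_zero d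
      neg_mem' := fun {a} ha d hd ↦ by rw [smul_neg, ha d hd] }
  have hDmem : ∀ t : Tor, t ∈ D ↔ ∀ d ∈ Dv, d • t = t := fun _ ↦ Iff.rfl
  let E₀K := (W.localMinimalIntegralModel v).nonsingularReductionSubgroup
    (integers_valuationRing_valuation (v.adicCompletionIntegers K) (v.adicCompletion K))
  let ι := closureEmb (K := K) (v.adicCompletion K)
  have hXid : X.baseChange (v.adicCompletion K) = X := by
    change X.map (algebraMap (v.adicCompletion K) (v.adicCompletion K)) = X
    rw [Algebra.algebraMap_self, WeierstrassCurve.map_id]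
  -- `D` is finite
  haveI hDfin : Finite D :=
    (finite_setOf_forall_decompositionSubgroup_smul_eq W p hpv (v := v)).to_subtype
  -- the `I`-fixed point underlying `t ∈ D`
  have hDI : ∀ t : D, ∀ i ∈ I, i • ((t : Tor) : W.geomPoints) = ((t : Tor) : W.geomPoints) :=
    fun t i hi ↦ by rw [← primaryComponent.coe_smul, t.2 i (hIle hi)]
  -- the descended points are `Γ_{K_v}`-fixed
  have hfixD : ∀ (t : D) (σ : absoluteGaloisGroup (v.adicCompletion K)),
      Affine.Point.map ((absoluteGaloisGroup.toAlgEquiv _ σ :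
          AlgebraicClosure (v.adicCompletion K) ≃ₐ[v.adicCompletion K]
            AlgebraicClosure (v.adicCompletion K)) :
          AlgebraicClosure (v.adicCompletion K) →ₐ[v.adicCompletion K]
            AlgebraicClosure (v.adicCompletion K))
        (Φ (pointsMapOfEmb W ι ((t : Tor) : W.geomPoints))) =
        Φ (pointsMapOfEmb W ι ((t : Tor) : W.geomPoints)) := by
    intro t σ
    rw [← transport_pointsMapOfEmb_smul hΦ]
    congr 2
    have hmem : resGalOfEmb ι σ ∈ Dv := by
      rw [hDvdef, ← decomp_eq_decompositionSubgroup_adicCompletionPrime v]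
      exact resGalOfEmb_closureEmb_mem_decomp v σ
    rw [← primaryComponent.coe_smul, t.2 _ hmem]
  -- Galois descent `d₀ : D → X(K_v)`
  have hdesc : ∀ t : D, ∃ R : (X.baseChange (v.adicCompletion K)).toAffine.Point,
      Affine.Point.map (W' := X)
        (Algebra.ofId (v.adicCompletion K) (AlgebraicClosure (v.adicCompletion K))) R =
        Φ (pointsMapOfEmb W ι ((t : Tor) : W.geomPoints)) :=
    fun t ↦ exists_point_map_eq_of_forall_map_eq X (hfixD t)
  choose d₀ hd₀ using hdesc
  have hinj := Affine.Point.map_injective (W' := X)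
    (Algebra.ofId (v.adicCompletion K) (AlgebraicClosure (v.adicCompletion K)))
  have hd₀_zero : d₀ 0 = 0 := hinj (by
    rw [hd₀, map_zero]
    change Φ (pointsMapOfEmb W ι (((0 : D) : Tor) : W.geomPoints)) = 0
    rw [ZeroMemClass.coe_zero, ZeroMemClass.coe_zero, map_zero, map_zero])
  have hd₀_add : ∀ P Q : D, d₀ (P + Q) = d₀ P + d₀ Q := fun P Q ↦ hinj (by
    rw [map_add, hd₀, hd₀, hd₀]
    change Φ (pointsMapOfEmb W ι ((((P : D) + (Q : D) : D) : Tor) : W.geomPoints)) = _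
    rw [AddSubgroup.coe_add, AddSubgroup.coe_add, map_add, map_add])
  let d : D →+ ((W.localMinimalIntegralModel v).baseChange (v.adicCompletion K)).toAffine.Point :=
    { toFun := fun P ↦ Affine.Point.congrEquiv hXid (d₀ P)
      map_zero' := by
        change Affine.Point.congrEquiv hXid (d₀ 0) = 0
        rw [hd₀_zero, map_zero]
      map_add' := fun P Q ↦ by
        change Affine.Point.congrEquiv hXid (d₀ (P + Q)) =
          Affine.Point.congrEquiv hXid (d₀ P) + Affine.Point.congrEquiv hXid (d₀ Q)
        rw [hd₀_add, map_add] }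
  have hd : ∀ P : D, d P = Affine.Point.congrEquiv hXid (d₀ P) := fun _ ↦ rfl
  -- `d t ∈ X₀(K_v) ↔ t` has non-singular reduction `↔ t ∈ core`
  have hbridge₀ : ∀ t : D, d t ∈ E₀K ↔
      (⟨((t : Tor) : W.geomPoints), fun i ↦ hDI t i i.2⟩ :
        FixedPoints.addSubgroup ↥((adicCompletionPrime K v).inertia (absoluteGaloisGroup K))
          W.geomPoints) ∈ nonsingularPart W hW₀ Φ := by
    intro t
    rw [mem_nonsingularReductionSubgroup_iff, mem_nonsingularPart_iff, hd, ← hd₀ t]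
    obtain hR0 | ⟨x₀, y₀, hxy, hR⟩ : d₀ t = 0 ∨ ∃ x₀ y₀ h, d₀ t = .some x₀ y₀ h := by
      rcases d₀ t with _ | ⟨x, y, h⟩
      exacts [Or.inl rfl, Or.inr ⟨x, y, h, rfl⟩]
    · rw [hR0, map_zero, map_zero, map_zero]
      exact iff_of_true WeierstrassCurve.hasNonsingularReduction_zero
        WeierstrassCurve.hasNonsingularReduction_zero
    · rw [hR, Affine.Point.congrEquiv_some, Affine.Point.map_some, Affine.Point.congrEquiv_some]
      exact (hasNonsingularReduction_algebraMap_iff hw (W.localMinimalIntegralModel v) h𝔐 hW₀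
        _ _).symm
  have hbridge : ∀ t : D, d t ∈ E₀K ↔ P (t : Tor) := by
    intro t
    rw [hbridge₀ t]
    exact ⟨fun h ↦ core_of_mem_nonsingularPart W p hw hW₀ hΦ hpv h𝔐 (t : Tor) _ rfl h,
      fun h ↦ mem_nonsingularPart_of_core W p hw hW₀ hΦ (t : Tor) h _ rfl⟩
  -- `δ : D → Φ_v`, kernel = core
  let δ : D →+ _ ⧸ E₀K := (QuotientAddGroup.mk' E₀K).comp d
  have hδ : ∀ t : D, δ t = QuotientAddGroup.mk (d t) := fun _ ↦ rfl
  have hker : ∀ t : D, t ∈ δ.ker ↔ P (t : Tor) := by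
    intro t
    rw [AddMonoidHom.mem_ker, hδ, QuotientAddGroup.eq_zero_iff, hbridge]
  -- finiteness of `Φ_v`
  have hcv0 : (W.baseChange (v.adicCompletion K)).localTamagawaNumber (v.adicCompletionIntegers K) ≠ 0 :=
    W.localTamagawaNumber_baseChange_ne_zero v
  haveI hE₀fi : E₀K.FiniteIndex :=
    ⟨by rw [← localTamagawaNumber_eq_index_nonsingularReductionSubgroup]; exact hcv0⟩
  haveI : Finite (((W.localMinimalIntegralModel v).baseChange (v.adicCompletion K)).toAffine.Point ⧸ E₀K) :=
    AddSubgroup.finite_quotient_of_finiteIndex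
  -- the image of `δ` contains the `p`-primary component of `Φ_v`
  have hrange : AddCommGroup.primaryComponent
      (((W.localMinimalIntegralModel v).baseChange (v.adicCompletion K)).toAffine.Point ⧸ E₀K) p ≤
      δ.range := by
    intro y hy
    obtain ⟨k, hk⟩ := (AddCommGroup.mem_primaryComponent).mp hy
    obtain ⟨x, rfl⟩ := QuotientAddGroup.mk_surjective y
    have hkx : p ^ k • x ∈ E₀K := by
      rw [← QuotientAddGroup.eq_zero_iff, QuotientAddGroup.mk_nsmul]; exact hk
    -- a rational `p`-power torsion point `t ≡ x`
    obtain ⟨t, ⟨s, hts⟩, htx⟩ :=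
      exists_torsion_sub_mem_nonsingularReductionSubgroup W hpv x ⟨k, hkx⟩
    -- `t` comes from a `D_v`-fixed `p`-power torsion point `Pt ∈ E(K̄)`
    set t₁ := (Affine.Point.congrEquiv hXid).symm t with ht₁
    set Q := Affine.Point.map (W' := X)
      (Algebra.ofId (v.adicCompletion K) (AlgebraicClosure (v.adicCompletion K))) t₁ with hQ
    have ht₁s : p ^ s • t₁ = 0 := by
      rw [ht₁, ← map_nsmul]
      exact (congrArg _ hts).trans (map_zero _)
    have hQs : p ^ s • Q = 0 := by rw [hQ, ← map_nsmul, ht₁s, map_zero]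
    obtain ⟨Pt, hPts, hPt⟩ := exists_pointsMapOfEmb_eq_of_nsmul_eq_zero W ι
      (pow_ne_zero s hpp.ne_zero) (Q := Φ.symm Q) (by rw [← map_nsmul, hQs, map_zero])
    have hΦPt : Φ (pointsMapOfEmb W ι Pt) = Q := by rw [hPt, AddEquiv.apply_symm_apply]
    have hPtfix : ∀ g ∈ Dv, g • Pt = Pt := by
      intro g hg
      rw [hDvdef, ← decomp_eq_decompositionSubgroup_adicCompletionPrime v] at hg
      obtain ⟨σ, rfl⟩ := exists_eq_resGalOfEmb_of_mem_decomp v hg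
      apply pointsMapOfEmb_injective W ι
      apply Φ.injective
      rw [transport_pointsMapOfEmb_smul hΦ, hΦPt, hQ]
      exact map_toAlgEquiv_map_ofId X t₁ σ
    have hPtprim : Pt ∈ W.geomPrimaryTorsion p :=
      (AddCommGroup.mem_primaryComponent).mpr ⟨s, hPts⟩
    let bP : D := ⟨⟨Pt, hPtprim⟩, fun g hg ↦ Subtype.ext (by
      rw [primaryComponent.coe_smul]; exact hPtfix g hg)⟩
    refine ⟨bP, ?_⟩
    have hdt : d bP = t := by
      rw [hd]
      have : d₀ bP = t₁ := hinj (by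
        rw [hd₀]
        change Φ (pointsMapOfEmb W ι Pt) = _
        rw [hΦPt, hQ])
      rw [this, ht₁, AddEquiv.apply_symm_apply]
    rw [hδ, hdt, QuotientAddGroup.eq_iff_sub_mem]
    exact htx
  -- the level-`n` count: `δ⁻¹(Φ_v[p^n]) = {t : p^n • t ∈ core}`
  set S := AddSubgroup.torsionBy
    (((W.localMinimalIntegralModel v).baseChange (v.adicCompletion K)).toAffine.Point ⧸ E₀K) (p ^ n : ℕ)
    with hSdef
  have hSle : S ≤ δ.range := fun y hy ↦
    hrange ((AddCommGroup.mem_primaryComponent).mpr ⟨n, AddSubgroup.torsionBy.nsmul_iff.mp hy⟩)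
  have hcount := natCard_comap_eq_card_ker_mul δ S hSle
  -- identify the three sets
  have hmemS : ∀ t : D, t ∈ S.comap δ ↔ P (p ^ n • (t : Tor)) := by
    intro t
    rw [AddSubgroup.mem_comap, hSdef, AddSubgroup.torsionBy.nsmul_iff, ← map_nsmul,
      ← AddMonoidHom.mem_ker, hker]
    rfl
  have e1 : Nat.card {t : Tor // (∀ d ∈ Dv, d • t = t) ∧ P (p ^ n • t)} = Nat.card (S.comap δ) := by
    refine Nat.card_congr ?_
    exact
      { toFun := fun t => ⟨⟨t.1, t.2.1⟩, (hmemS ⟨t.1, t.2.1⟩).mpr t.2.2⟩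
        invFun := fun t => ⟨((t : S.comap δ) : D), ((t : S.comap δ) : D).2, (hmemS _).mp t.2⟩
        left_inv := fun t => rfl
        right_inv := fun t => rfl }
  have e2 : Nat.card {t : Tor // (∀ d ∈ Dv, d • t = t) ∧ P t} = Nat.card δ.ker := by
    refine Nat.card_congr ?_
    exact
      { toFun := fun t => ⟨⟨t.1, t.2.1⟩, (hker _).mpr t.2.2⟩
        invFun := fun t => ⟨((t : δ.ker) : D), ((t : δ.ker) : D).2, (hker _).mp t.2⟩
        left_inv := fun t => rfl
        right_inv := fun t => rfl }
  rw [e1, e2, hcount]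

end Count

end Summit.BirchSwinnertonDyer.BirchSwinnertonDyer.Theorems.KimAtThreeD7uTamagawaComponent

end
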